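import Summits.QuantumFields.BalabanUV.Beta.WardLocusResidualWall

/-!
# `BalabanUV.Beta.WardLocusResidualSlot` — binder row D1, SECOND-ORDER hW (W-side), SLOT-GENERIC parts Q1∕Q2: the CLASS and the ROW PARITY of the
# residual of the kernel law `hWd j` (`WardLocusRecursiveStepSlot.divW_WrecOf_of_tableLaws`) and of the next level's transported remainder, for a
# GENERIC decaying resolvent `K`, generic localised first-order tables `S`, `M` and the pinned block generator — the twin of `WardLocusResidualWall` with
# `(coDressKBmAt ρ Lc (KInvStep Lc j), SpureRecAt j, M1At j)` replaced by SLOTS `(K, S, M)` under DISPLAYED class ∕ parity letters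
# (β sub-cell, BINDER-OWNERS row D1 OWNER `b2b-balaban-beta-an2`, gen 29; INTENT «SYM-hW-SECOND-ORDER» journal [AN2-G29-ONLINE])

HONEST FRAMING (cell charter, verbatim): «discharging BetaPertH makes Bałaban's UV stability UNCONDITIONAL — a real constructive-QFT result; it is
NOT the continuum limit and NOT the Clay problem.»  HONEST DEPENDENCY: continuum YM on T⁴ ⇐ BetaPertH ∧ nine spine estimates (0/9 proved);
BetaPertH ⇐ (D1) ∧ (D4) ∧ CAP+tail; G-an2-4 gates asym, D1 and NE2/3/4.
NOT IN PRINT; OUR BOOKKEEPING.  [folklore] composition of leaf-06's generic `WardLocusResidualClass` (class), an1's `KernelWardResidual.parityOdd_residual` ∕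
`parityOdd_dM` and leaf-05's `SpineRecursiveParity` parity algebra (`parityOdd_smul`∕`_sum`∕`_sandwich`∕`_mmRead`); the resolvent's decay ∕ sgn-symmetry, the
tables' classes and ROW PARITIES and the remainders' classes ∕ parities are DISPLAYED HYPOTHESES; no statement of Bałaban's papers, no `[cite:]`, no `def`,
no `def … : Prop`; instantiates NO binder of the β-function wall.  NOT hW, NOT D1, NOT `BetaPertH`, NOT continuum, NOT Clay.

* §1 **`exists_vertexFamily_residual_slot`** (the residual `½ • (𝒩 + 𝒩″)` is a vertex family in `(ν, y′)` uniformly in `y`) and **`parityOdd_residual_slot`**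
  (it is row-parity-odd when the rows of `S`, `M`, `R y`, `R″ y`, `RM y` are).
* §2 the next level's transported remainder `a • Σ_v mmRead Lc (K ∘ 𝒩 (Lc•Y+v) κ′ u′ ∘ K) + RB Y κ′ u′`: **`exists_locStencil_transport_slot`** (class),
  **`exists_bound_transport_slot`** (uniform bound of the sandwich sum), **`parityOdd_transport_slot`** (row parity, from `Spr K`, `trK K = sgnK K`, the
  residual's localisation + parity and the border remainder's parity).
Instances: the comb (`WardLocusResidualWall`) and the (0.4) literal (`K := Gsym Lc j`, `S := SpureSymOf tabs … j`, `M := tabs.M j`; `trK (Gsym Lc j) = sgnK (Gsym Lc j)`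
is `KernelWardSymEnd.trK_coDressKSymAt_KInvStep`).
Provenance: β sub-cell, unit beta-an2 gen 29, 2026-08-21 (v1); over the files named above BY NAME; no existing file touched.
-/

noncomputable section

open Finset
open scoped BigOperators
open Literature.MathematicalPhysics.QuantumFieldTheory
open Literature.MathematicalPhysics.QuantumFieldTheory.Balaban1983to89
open Literature.MathematicalPhysics.QuantumFieldTheory.Balaban1983to89.Beta
open B12Sec2to5 (l1 l1_nonneg)
open ExpKernelCalculus (MKer Decays BiLoc VertexFamily comp)
open KernelWard (divV divW bdd_of_biLoc)
open AffineAveraging (Site box toSite)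
open OneStepResolventKernel (Fib wsum LocStencil biLoc_mono decays_mono)
open OneStepKernelFamily (colH vertexOfK)
open InterLevelTransport (cwsum)
open BalabanStepJetsSucc (mmRead)
open SecondOrderResponse (colM vertexOfM dM)
open StepJetData (locStencil_add locStencil_smul)
open Summit.QuantumFields.BalabanUV.Beta.TameKernelCalculus
open Summit.QuantumFields.BalabanUV.Beta.BorderedHessian (diagK sgnK)
open Summit.QuantumFields.BalabanUV.Beta.ChartConjugation (conjV)
open Summit.QuantumFields.BalabanUV.Beta.AveragingWardRootedStencils (legInd)
open Summit.QuantumFields.BalabanUV.Beta.KernelWardRelative (gaugeWt)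
open Summit.QuantumFields.BalabanUV.Beta.KernelWardResidual (parityOdd_residual parityOdd_dM)
open Summit.QuantumFields.BalabanUV.Beta.KernelWardRemainderParity (parityOdd_add)
open Summit.QuantumFields.BalabanUV.Beta.SpineRecursiveParity (parityOdd_smul parityOdd_sum parityOdd_sandwich parityOdd_mmRead)
open Summit.QuantumFields.BalabanUV.Beta.WardLocusResidualClass (exists_vertexFamily_residual exists_vertexFamily_residual'' exists_vertexFamily_halfSum
  exists_locStencil_transport abs_transport_le abs_blockGen_le)

namespace Summit.QuantumFields.BalabanUV.Beta.WardLocusResidualSlot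

section Slot

variable {d Lc : ℕ} [NeZero Lc]
variable {K : MKer (d + 1) (Fib d)} {S M : Fin (d + 1) → (Fin (d + 1) → ℤ) → MKer (d + 1) (Fib d)}

/-! ## §1 The residual of `hWd j` at the slots: vertex-family class and row parity -/

/-- [folklore] **THE WARD RESIDUAL OF THE SLOTTED W-TABLES IS A VERTEX FAMILY IN ITS BOND VARIABLE, UNIFORMLY IN THE COARSE SITE**: for a decaying
resolvent `K`, localised tables `S` (local-stencil) and `M` (vertex family), remainders `R y`, `R″ y` local-stencil families and `RM y` vertex families at one
rate each, any contact constant `cH`, any root `r` and generator scale `ξ`, the residual `½ • (𝒩 + 𝒩″)` of `WardLocusRecursiveStepSlot.divW_WrecOf_of_tableLaws`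
satisfies `∀ y, VertexFamily (fun ν y′ ↦ …) Lc C δ` for some `C`, `δ > 0` (leaf-06's generic `WardLocusResidualClass` at one common rate). -/
theorem exists_vertexFamily_residual_slot (hK : ∃ δ C : ℝ, 0 < δ ∧ 0 ≤ C ∧ Decays K C δ)
    (hS : ∃ Cs δ : ℝ, 0 < δ ∧ LocStencil S Cs δ) (hM : ∃ CM δ : ℝ, 0 < δ ∧ VertexFamily M Lc CM δ) (cH : ℝ) (r : Fin (d + 1) → ℕ) (ξ : ℝ)
    {R R'' : (Fin (d + 1) → ℤ) → Fin (d + 1) → (Fin (d + 1) → ℤ) → MKer (d + 1) (Fib d)}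
    {RM : (Fin (d + 1) → ℤ) → Fin (d + 1) → (Fin (d + 1) → ℤ) → MKer (d + 1) (Fib d)} {CR CR'' CRM mR mR'' mRM : ℝ}
    (hmR : 0 < mR) (hRl : ∀ y, LocStencil (R y) CR mR) (hmR'' : 0 < mR'') (hR''l : ∀ y, LocStencil (R'' y) CR'' mR'')
    (hmRM : 0 < mRM) (hRMl : ∀ y, VertexFamily (RM y) Lc CRM mRM) :
    ∃ C δ : ℝ, 0 < δ ∧ ∀ y : Fin (d + 1) → ℤ, VertexFamily (fun ν y' => (1 / 2 : ℝ) • (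
          (dM K Lc (R y) (RM y) ν y'
            - cH • (∑ κ, wsum (fun u => ∑' x₂, ∑ κ₂,
                comp K (dM K Lc S M ν y') u x₂ (Sum.inl κ) (Sum.inl κ₂) * gaugeWt Lc y κ₂ x₂) (S κ)
              + ∑ ρ', cwsum Lc (fun w => ∑' x₂, ∑ κ₂,
                comp K (dM K Lc S M ν y') ((Lc : ℤ) • w) x₂ (Sum.inr ρ') (Sum.inl κ₂) * gaugeWt Lc y κ₂ x₂) (M ρ')))
          + (dM K Lc (R'' y) (RM y) ν y'
            + dM (conjV K (diagK (ξ • ∑ v ∈ box (d + 1) Lc, legInd (toSite r) ((Lc : ℤ) • y + toSite v)))) Lc S M ν y'))) Lc C δ := by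
  obtain ⟨δK, CK, hδK, hCK, hKd⟩ := hK
  obtain ⟨Cs, δs, hδs, hSl⟩ := hS
  obtain ⟨CM, δM, hδM, hMl⟩ := hM
  -- one common rate
  set m : ℝ := min (min mR (min mR'' mRM)) (min δs (min δM δK)) with hmdef
  have hm : 0 < m := lt_min (lt_min hmR (lt_min hmR'' hmRM)) (lt_min hδs (lt_min hδM hδK))
  have hmR1 : m ≤ mR := (min_le_left _ _).trans (min_le_left _ _)
  have hmR2 : m ≤ mR'' := (min_le_left _ _).trans ((min_le_right _ _).trans (min_le_left _ _))
  have hmR3 : m ≤ mRM := (min_le_left _ _).trans ((min_le_right _ _).trans (min_le_right _ _))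
  have hmS : m ≤ δs := (min_le_right _ _).trans (min_le_left _ _)
  have hmM : m ≤ δM := (min_le_right _ _).trans ((min_le_right _ _).trans (min_le_left _ _))
  have hmK : m ≤ δK := (min_le_right _ _).trans ((min_le_right _ _).trans (min_le_right _ _))
  have hKd' : Decays K CK m := decays_mono hKd hCK le_rfl hmK
  have hS' : LocStencil S (|Cs|) m := fun κ u => biLoc_of_le (hSl κ u) hmS
  have hM' : VertexFamily M Lc (|CM|) m := fun ρ w => biLoc_of_le (hMl ρ w) hmM
  have hRl' : ∀ y, LocStencil (R y) (|CR|) m := fun y κ u => biLoc_of_le (hRl y κ u) hmR1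
  have hR''l' : ∀ y, LocStencil (R'' y) (|CR''|) m := fun y κ u => biLoc_of_le (hR''l y κ u) hmR2
  have hRMl' : ∀ y, VertexFamily (RM y) Lc (|CRM|) m := fun y ρ' w => biLoc_of_le (hRMl y ρ' w) hmR3
  obtain ⟨C₁, h₁⟩ := exists_vertexFamily_residual hKd' hCK hm hS' hM' hRl' hRMl' cH
  obtain ⟨C₂, h₂⟩ := exists_vertexFamily_residual'' hKd' hCK hm hS' hM' hR''l' hRMl'
    (g := fun y => ξ • ∑ v ∈ box (d + 1) Lc, legInd (toSite r) ((Lc : ℤ) • y + toSite v))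
    (fun y z b => abs_blockGen_le Lc (toSite r) ξ y z b)
  obtain ⟨C', h'⟩ := exists_vertexFamily_halfSum (show m / 8 ≤ m / 2 by linarith [hm.le]) h₁ h₂
  exact ⟨C', m / 8, by positivity, h'⟩

omit [NeZero Lc] in
/-- [folklore] **THE WARD RESIDUAL OF THE SLOTTED W-TABLES IS ROW-PARITY-ODD** (any resolvent `K`, any `cH`, `r`, `ξ`; no class needed): if the rows of `S`, `M`,
`R y`, `R″ y`, `RM y` are parity-odd, so is `½ • (𝒩 + 𝒩″)` — an1's `parityOdd_residual` + `parityOdd_dM` ×2. -/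
theorem parityOdd_residual_slot (hSp : ∀ κ u, trK (S κ u) = -sgnK (S κ u)) (hMp : ∀ ρ w, trK (M ρ w) = -sgnK (M ρ w)) (cH : ℝ)
    (r : Fin (d + 1) → ℕ) (ξ : ℝ)
    {R R'' : (Fin (d + 1) → ℤ) → Fin (d + 1) → (Fin (d + 1) → ℤ) → MKer (d + 1) (Fib d)}
    {RM : (Fin (d + 1) → ℤ) → Fin (d + 1) → (Fin (d + 1) → ℤ) → MKer (d + 1) (Fib d)}
    (hRp : ∀ y κ u, trK (R y κ u) = -sgnK (R y κ u)) (hR''p : ∀ y κ u, trK (R'' y κ u) = -sgnK (R'' y κ u))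
    (hRMp : ∀ y ρ' w, trK (RM y ρ' w) = -sgnK (RM y ρ' w)) (y : Fin (d + 1) → ℤ) (ν : Fin (d + 1)) (y' : Fin (d + 1) → ℤ) :
    trK ((1 / 2 : ℝ) • (
          (dM K Lc (R y) (RM y) ν y'
            - cH • (∑ κ, wsum (fun u => ∑' x₂, ∑ κ₂,
                comp K (dM K Lc S M ν y') u x₂ (Sum.inl κ) (Sum.inl κ₂) * gaugeWt Lc y κ₂ x₂) (S κ)
              + ∑ ρ', cwsum Lc (fun w => ∑' x₂, ∑ κ₂,
                comp K (dM K Lc S M ν y') ((Lc : ℤ) • w) x₂ (Sum.inr ρ') (Sum.inl κ₂) * gaugeWt Lc y κ₂ x₂) (M ρ')))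
          + (dM K Lc (R'' y) (RM y) ν y'
            + dM (conjV K (diagK (ξ • ∑ v ∈ box (d + 1) Lc, legInd (toSite r) ((Lc : ℤ) • y + toSite v)))) Lc S M ν y'))) =
      -sgnK ((1 / 2 : ℝ) • (
          (dM K Lc (R y) (RM y) ν y'
            - cH • (∑ κ, wsum (fun u => ∑' x₂, ∑ κ₂,
                comp K (dM K Lc S M ν y') u x₂ (Sum.inl κ) (Sum.inl κ₂) * gaugeWt Lc y κ₂ x₂) (S κ)
              + ∑ ρ', cwsum Lc (fun w => ∑' x₂, ∑ κ₂,
                comp K (dM K Lc S M ν y') ((Lc : ℤ) • w) x₂ (Sum.inr ρ') (Sum.inl κ₂) * gaugeWt Lc y κ₂ x₂) (M ρ')))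
          + (dM K Lc (R'' y) (RM y) ν y'
            + dM (conjV K (diagK (ξ • ∑ v ∈ box (d + 1) Lc, legInd (toSite r) ((Lc : ℤ) • y + toSite v)))) Lc S M ν y'))) :=
  parityOdd_smul _ (parityOdd_add
    (parityOdd_residual (N := Lc) _ hSp hMp hRp hRMp _ y ν y')
    (parityOdd_add (parityOdd_dM (N := Lc) _ (hR''p y) (hRMp y) ν y') (parityOdd_dM (N := Lc) _ hSp hMp ν y')))

/-! ## §2 The transported remainder of the next level: class, bound, parity -/

omit [NeZero Lc] in
/-- [folklore] **THE NEXT LEVEL's TRANSPORTED REMAINDER IS A LOCAL STENCIL FAMILY, UNIFORMLY**: from the vertex-family class of the level-`j` residual `𝒩`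
(all coarse sites, one constant, rate `δN`), a decaying resolvent `K` and a local-stencil border remainder `RB Y` (uniform, rate `δB`):
`∀ Y, LocStencil (fun κ′ u′ ↦ a • Σ_{v ∈ box} mmRead Lc (K ∘ 𝒩 (Lc•Y+v) κ′ u′ ∘ K) + RB Y κ′ u′) C δ′` for some `C`, `δ′ > 0`
(leaf-06's `exists_locStencil_transport`, `locStencil_smul`, `locStencil_add`). -/
theorem exists_locStencil_transport_slot (hLc : 1 ≤ Lc) (hK : ∃ δ C : ℝ, 0 < δ ∧ 0 ≤ C ∧ Decays K C δ) (a : ℝ)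
    {𝒩 : (Fin (d + 1) → ℤ) → Fin (d + 1) → (Fin (d + 1) → ℤ) → MKer (d + 1) (Fib d)} {CN δN : ℝ} (hδN : 0 < δN)
    (h𝒩 : ∀ w, VertexFamily (𝒩 w) Lc CN δN)
    {RB : (Fin (d + 1) → ℤ) → Fin (d + 1) → (Fin (d + 1) → ℤ) → MKer (d + 1) (Fib d)} {CB δB : ℝ} (hδB : 0 < δB)
    (hRB : ∀ Y, LocStencil (RB Y) CB δB) :
    ∃ C δ' : ℝ, 0 < δ' ∧ ∀ Y : Fin (d + 1) → ℤ, LocStencil (fun κ' u' =>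
      a • ∑ v ∈ box (d + 1) Lc, mmRead Lc (comp (comp K (𝒩 ((Lc : ℤ) • Y + toSite v) κ' u')) K) + RB Y κ' u') C δ' := by
  obtain ⟨δK, CK, hδK, hCK, hKd⟩ := hK
  set m : ℝ := min (min δN δB) δK with hmdef
  have hm : 0 < m := lt_min (lt_min hδN hδB) hδK
  have hKd' : Decays K CK m := decays_mono hKd hCK le_rfl (min_le_right _ _)
  have h𝒩' : ∀ w, VertexFamily (𝒩 w) Lc (|CN|) m := fun w ν y' => biLoc_of_le (h𝒩 w ν y') ((min_le_left _ _).trans (min_le_left _ _))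
  obtain ⟨C₁, h₁⟩ := exists_locStencil_transport (N := Lc) hLc hKd' hCK hm h𝒩'
  have hmB : m ≤ δB := (min_le_left _ _).trans (min_le_right _ _)
  have hRB' : ∀ Y, LocStencil (RB Y) (|CB|) (m / 4) := fun Y κ u => biLoc_of_le (hRB Y κ u) (by linarith [hm.le])
  refine ⟨|a| * C₁ + |CB|, m / 4, by positivity, fun Y => ?_⟩
  exact locStencil_add (locStencil_smul a (h₁ Y)) (hRB' Y)

omit [NeZero Lc] in
/-- [folklore] **… HENCE THE TRANSPORTED SANDWICH SUM IS UNIFORMLY BOUNDED** (the `h𝒩b` input of `WardLocusRecursiveAllSlot.divW_WrecOf_succ_of_kernelLaw`). -/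
theorem exists_bound_transport_slot (hLc : 1 ≤ Lc) (hK : ∃ δ C : ℝ, 0 < δ ∧ 0 ≤ C ∧ Decays K C δ)
    {𝒩 : (Fin (d + 1) → ℤ) → Fin (d + 1) → (Fin (d + 1) → ℤ) → MKer (d + 1) (Fib d)} {CN δN : ℝ} (hδN : 0 < δN)
    (h𝒩 : ∀ w, VertexFamily (𝒩 w) Lc CN δN) :
    ∃ B : ℝ, ∀ (Y : Fin (d + 1) → ℤ) (κ' : Fin (d + 1)) (u' x z : Fin (d + 1) → ℤ) (a b : Fib d),
      |(∑ v ∈ box (d + 1) Lc, mmRead Lc (comp (comp K (𝒩 ((Lc : ℤ) • Y + toSite v) κ' u')) K)) x z a b| ≤ B := by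
  obtain ⟨δK, CK, hδK, hCK, hKd⟩ := hK
  set m : ℝ := min δN δK with hmdef
  have hm : 0 < m := lt_min hδN hδK
  have hKd' : Decays K CK m := decays_mono hKd hCK le_rfl (min_le_right _ _)
  have h𝒩' : ∀ w, VertexFamily (𝒩 w) Lc (|CN|) m := fun w ν y' => biLoc_of_le (h𝒩 w ν y') (min_le_left _ _)
  exact abs_transport_le (N := Lc) hLc hKd' hCK hm h𝒩'

omit [NeZero Lc] in
/-- [folklore] **THE NEXT LEVEL's TRANSPORTED REMAINDER IS ROW-PARITY-ODD** when the residual `𝒩` is (and is localised), the resolvent `K` is spread and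
sgn-symmetric, and the border remainder's rows are parity-odd (leaf-05's `parityOdd_sandwich`, `parityOdd_mmRead`, `parityOdd_sum`, `parityOdd_smul`). -/
theorem parityOdd_transport_slot (hKs : Spr K) (hKt : trK K = sgnK K) (a : ℝ)
    {𝒩 : (Fin (d + 1) → ℤ) → Fin (d + 1) → (Fin (d + 1) → ℤ) → MKer (d + 1) (Fib d)} (h𝒩l : ∀ w ν y', Loc (𝒩 w ν y'))
    (h𝒩p : ∀ w ν y', trK (𝒩 w ν y') = -sgnK (𝒩 w ν y'))
    {RB : (Fin (d + 1) → ℤ) → Fin (d + 1) → (Fin (d + 1) → ℤ) → MKer (d + 1) (Fib d)} (hRBp : ∀ Y κ u, trK (RB Y κ u) = -sgnK (RB Y κ u))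
    (Y : Fin (d + 1) → ℤ) (κ' : Fin (d + 1)) (u' : Fin (d + 1) → ℤ) :
    trK (a • ∑ v ∈ box (d + 1) Lc, mmRead Lc (comp (comp K (𝒩 ((Lc : ℤ) • Y + toSite v) κ' u')) K) + RB Y κ' u') =
      -sgnK (a • ∑ v ∈ box (d + 1) Lc, mmRead Lc (comp (comp K (𝒩 ((Lc : ℤ) • Y + toSite v) κ' u')) K) + RB Y κ' u') := by
  refine parityOdd_add (parityOdd_smul a (parityOdd_sum _ fun v _ => ?_)) (hRBp Y κ' u')
  exact parityOdd_mmRead Lc (parityOdd_sandwich hKs (h𝒩l _ κ' u') hKt (h𝒩p _ κ' u'))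

end Slot

end Summit.QuantumFields.BalabanUV.Beta.WardLocusResidualSlot

end
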